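import Literature.NumberTheory.Transcendental.KontsevichZagierZetaProofs
import Literature.NumberTheory.Transcendental.BeukersZetaThreeIntegralsLegendreProofs
import HarnessLib

/-!
# `ζ(n)` as a box integral: `∫_{(0,1)ⁿ} dx/(1 − x₀⋯x_{n−1}) = Σ_{k≥1} k⁻ⁿ = ζ(n)` (`n ≥ 2`)

The standard presentation of the zeta values as Kontsevich–Zagier periods over the open unit
box (expand `1/(1 − x₀⋯x_{n−1}) = Σ_k (x₀⋯x_{n−1})ᵏ` and integrate term-wise:
`∫_{(0,1)ⁿ}(x₀⋯x_{n−1})ᵏ = (k+1)⁻ⁿ`; for `n = 2` this is the double integral of Beukers'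
irrationality proof of `ζ(2)`, for `n = 3` the weight-`3` calibration integral `ζ(3)`), written in
the literal shape `∫ x in {x : Fin n → ℝ | ∀ i, x i ∈ Ioo 0 1}, …` of the tree's Kontsevich–Zagier
calculus (`Literature.NumberTheory.Transcendental.KZ.IntegralRep`, `KZ.unitCube`;
`BeukersZetaThreeIntegrals.lean`) and of the route items quoting it (summit KontsevichZagierPeriods,
route HurwitzMicroSectors: "`1/(1−xy)` is integrable on the open unit box and
`∫∫ dxdy/(1−xy) = π²/6`"; "`∫(0,1)³ 1/(1−xyz)` must be identified with `zetaValue 3`").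

* `BoxIntegral.integrableOn_box_one_div_one_sub_prod` — for `n ≥ 2` the (unbounded) kernel
  `1/(1 − ∏ᵢ xᵢ)` is integrable on the open box: it is dominated by the integrable product
  `∏ᵢ (1 − xᵢ)^{−1/n}` because `∏ᵢ xᵢ ≤ xᵢ` for each `i` (`one_div_one_sub_prod_le`);
* `BoxIntegral.setIntegral_box_one_div_one_sub_prod`,
  `BoxIntegral.setIntegral_box_one_div_one_sub_prod_eq_zetaValue` —
  **`∫_{(0,1)ⁿ} dx/(1 − ∏ᵢ xᵢ) = Σ_{k≥0} (k+1)⁻ⁿ = zetaValue n`** (`n ≥ 2`; term-wise integration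
  by `hasSum_integral_of_summable_integral_norm`, Fubini `integral_fintype_prod_eq_pow`, and the
  tree's `zetaValue n = Σ' m, 1/mⁿ` of `PeriodsWave0.lean`);
* `box_integral_one_div_one_sub_mul_two` — `n = 2` in coordinates:
  `1/(1 − x₀x₁)` is integrable on the open box and `∫ = π²/6` (`hasSum_zeta_two`);
* `box_integral_one_div_one_sub_mul_three` — `n = 3` in coordinates:
  `1/(1 − x₀x₁x₂)` is integrable on the open box and `∫ = zetaValue 3`.

No named facts (D-0026); everything is proved. Beukers' weighted integrals `∫∫ xʳyˢ/(1−xy)` and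
the `-log(xy)` kernels are not here (`BeukersZetaThreeIntegrals.lean`).

## References

* [Beukers1979] F. Beukers, *A note on the irrationality of `ζ(2)` and `ζ(3)`*, Bull. London Math.
  Soc. 11 (1979) 268–272 (the integrals `∫₀¹∫₀¹ xʳyˢ dxdy/(1−xy)`).
* [KontsevichZagier2001] M. Kontsevich, D. Zagier, *Periods* (2001), §1.1.
-/

noncomputable section

open MeasureTheory Set Filter Real Finset

namespace Literature.NumberTheory.Transcendental

namespace BoxIntegral

variable {n : ℕ}

/-! ### The open unit box of `Fin n → ℝ` and its volume -/

/-! The open unit box as a product set, its measurability and `volume.restrict` as a product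
measure are the tree's `Beukers.setOf_forall_mem_Ioo_eq_pi`, `Beukers.measurableSet_cube`,
`Beukers.volume_restrict_cube` (`BeukersZetaThreeIntegralsLegendreProofs.lean`), reused here. -/

/-- On the closed unit box the product of the coordinates is at most each coordinate. [folklore] -/
theorem prod_le_apply {x : Fin n → ℝ} (hx : ∀ j, x j ∈ Icc (0 : ℝ) 1) (i : Fin n) :
    ∏ j, x j ≤ x i := by
  rw [← Finset.mul_prod_erase univ x (mem_univ i)]
  exact mul_le_of_le_one_right (hx i).1
    (Finset.prod_le_one (fun j _ => (hx j).1) fun j _ => (hx j).2)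

/-- On the open unit box the product of the coordinates lies in `(0,1)` (`n ≥ 1`). [folklore] -/
theorem prod_mem_Ioo (hn : n ≠ 0) {x : Fin n → ℝ} (hx : ∀ i, x i ∈ Ioo (0 : ℝ) 1) :
    ∏ i, x i ∈ Ioo (0 : ℝ) 1 := by
  obtain ⟨i⟩ : Nonempty (Fin n) := Fin.pos_iff_nonempty.mp (Nat.pos_of_ne_zero hn)
  exact ⟨Finset.prod_pos fun j _ => (hx j).1,
    (prod_le_apply (fun j => Ioo_subset_Icc_self (hx j)) i).trans_lt (hx i).2⟩

/-! ### The monomials `(x₀⋯x_{n−1})ᵏ`: integrability and integrals -/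

/-- `∫_{(0,1)} tᵏ dt = 1/(k+1)` for Lebesgue measure restricted to `(0,1)`. [folklore] -/
theorem integral_restrict_Ioo_pow (k : ℕ) :
    ∫ t, t ^ k ∂(volume : Measure ℝ).restrict (Ioo (0 : ℝ) 1) = 1 / ((k : ℝ) + 1) := by
  rw [← integral_Ioc_eq_integral_Ioo, ← intervalIntegral.integral_of_le zero_le_one, integral_pow,
    one_pow, zero_pow (Nat.succ_ne_zero k), sub_zero]

/-- `tᵏ` is integrable on `(0,1)`. [folklore] -/
theorem integrable_restrict_Ioo_pow (k : ℕ) :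
    Integrable (fun t : ℝ => t ^ k) ((volume : Measure ℝ).restrict (Ioo (0 : ℝ) 1)) :=
  ((continuous_pow k).continuousOn.integrableOn_compact isCompact_Icc).mono_set Ioo_subset_Icc_self

/-- **`∫_{(0,1)ⁿ} (x₀⋯x_{n−1})ᵏ dx = (1/(k+1))ⁿ`** (Fubini: the integral of a product of functions
of the separate coordinates is the product of the integrals). [folklore] -/
theorem setIntegral_box_prod_pow (n k : ℕ) :
    ∫ x in {x : Fin n → ℝ | ∀ i, x i ∈ Ioo (0 : ℝ) 1}, (∏ i, x i) ^ k = (1 / ((k : ℝ) + 1)) ^ n := by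
  rw [Beukers.volume_restrict_cube]
  simp_rw [← Finset.prod_pow]
  have h := integral_fintype_prod_eq_pow (ι := Fin n) (fun t : ℝ => t ^ k)
    (μ := (volume : Measure ℝ).restrict (Ioo (0 : ℝ) 1))
  simp only [Fintype.card_fin, integral_restrict_Ioo_pow] at h
  exact h

/-- The monomials `(x₀⋯x_{n−1})ᵏ` are integrable on the open unit box. [folklore] -/
theorem integrableOn_box_prod_pow (n k : ℕ) :
    IntegrableOn (fun x : Fin n → ℝ => (∏ i, x i) ^ k) {x | ∀ i, x i ∈ Ioo (0 : ℝ) 1} volume := by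
  rw [IntegrableOn, Beukers.volume_restrict_cube]
  simp_rw [← Finset.prod_pow]
  exact Integrable.fintype_prod fun _ => integrable_restrict_Ioo_pow k

/-! ### Integrability of `1/(1 − x₀⋯x_{n−1})` on the open box (`n ≥ 2`) -/

/-- `(1−t)^{−1/n}` is integrable on `(0,1)` as soon as `n ≥ 2` (exponent `> −1`). [folklore] -/
theorem integrable_restrict_Ioo_one_sub_rpow (hn : 2 ≤ n) :
    Integrable (fun t : ℝ => (1 - t) ^ (-(1 / (n : ℝ))))
      ((volume : Measure ℝ).restrict (Ioo (0 : ℝ) 1)) := by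
  have hn' : (-1 : ℝ) < -(1 / (n : ℝ)) := by
    have : (2 : ℝ) ≤ n := by exact_mod_cast hn
    rw [neg_lt_neg_iff, div_lt_one (by linarith)]
    linarith
  have h := (intervalIntegral.intervalIntegrable_rpow' (a := (1 : ℝ)) (b := 0) hn').comp_sub_left 1
  simp only [sub_self, sub_zero] at h
  exact (intervalIntegrable_iff_integrableOn_Ioo_of_le zero_le_one).mp h

/-- **The domination**: on the open unit box, `1/(1 − x₀⋯x_{n−1}) ≤ ∏ᵢ (1 − xᵢ)^{−1/n}` — since
`x₀⋯x_{n−1} ≤ xᵢ` for every `i`, `∏ᵢ(1 − xᵢ) ≤ (1 − x₀⋯x_{n−1})ⁿ`. [folklore] -/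
theorem one_div_one_sub_prod_le (hn : n ≠ 0) {x : Fin n → ℝ} (hx : ∀ i, x i ∈ Ioo (0 : ℝ) 1) :
    1 / (1 - ∏ i, x i) ≤ ∏ i, (1 - x i) ^ (-(1 / (n : ℝ))) := by
  have hu := prod_mem_Ioo hn hx
  set u := ∏ i, x i with hu_def
  have h1u : 0 < 1 - u := by linarith [hu.2]
  have hxi : ∀ i, 0 ≤ 1 - x i := fun i => by linarith [(hx i).2]
  -- `∏ (1 - xᵢ) ≤ (1 - u)^n`
  have hprod : ∏ i, (1 - x i) ≤ (1 - u) ^ n := by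
    calc ∏ i, (1 - x i) ≤ ∏ _i : Fin n, (1 - u) :=
          Finset.prod_le_prod (fun i _ => hxi i) fun i _ => by
            linarith [prod_le_apply (fun j => Ioo_subset_Icc_self (hx j)) i]
      _ = (1 - u) ^ n := by rw [Finset.prod_const, Finset.card_univ, Fintype.card_fin]
  have hP0 : 0 ≤ ∏ i, (1 - x i) := Finset.prod_nonneg fun i _ => hxi i
  have hP : 0 < ∏ i, (1 - x i) := Finset.prod_pos fun i _ => by linarith [(hx i).2]
  -- take `n`-th roots
  have hroot : (∏ i, (1 - x i)) ^ (1 / (n : ℝ)) ≤ 1 - u := by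
    have h := Real.rpow_le_rpow hP0 hprod (by positivity : (0 : ℝ) ≤ 1 / n)
    rwa [← Real.rpow_natCast (1 - u) n, ← Real.rpow_mul h1u.le, mul_one_div_cancel
      (by exact_mod_cast hn : (n : ℝ) ≠ 0), Real.rpow_one] at h
  calc 1 / (1 - u) ≤ 1 / (∏ i, (1 - x i)) ^ (1 / (n : ℝ)) :=
        one_div_le_one_div_of_le (Real.rpow_pos_of_pos hP _) hroot
    _ = (∏ i, (1 - x i)) ^ (-(1 / (n : ℝ))) := by rw [Real.rpow_neg hP0, one_div]
    _ = ∏ i, (1 - x i) ^ (-(1 / (n : ℝ))) := (Real.finsetProd_rpow _ _ (fun i _ => hxi i) _).symm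

/-- **`1/(1 − x₀⋯x_{n−1})` is integrable on the open unit box for `n ≥ 2`** (dominated by the
integrable product `∏ᵢ (1 − xᵢ)^{−1/n}`; for `n = 1` the integral `∫₀¹ dt/(1−t)` diverges).
[folklore] -/
theorem integrableOn_box_one_div_one_sub_prod (hn : 2 ≤ n) :
    IntegrableOn (fun x : Fin n → ℝ => 1 / (1 - ∏ i, x i)) {x | ∀ i, x i ∈ Ioo (0 : ℝ) 1} volume := by
  have hn0 : n ≠ 0 := by omega
  rw [IntegrableOn, Beukers.volume_restrict_cube]
  have hg : Integrable (fun x : Fin n → ℝ => ∏ i, (1 - x i) ^ (-(1 / (n : ℝ))))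
      (Measure.pi fun _ : Fin n => (volume : Measure ℝ).restrict (Ioo (0 : ℝ) 1)) :=
    Integrable.fintype_prod fun _ => integrable_restrict_Ioo_one_sub_rpow hn
  refine hg.mono' ((by fun_prop : Measurable fun x : Fin n → ℝ => 1 / (1 - ∏ i, x i)).aestronglyMeasurable) ?_
  rw [← Beukers.volume_restrict_cube]
  refine ae_restrict_of_forall_mem (Beukers.measurableSet_cube n) fun x hx => ?_
  have hu := prod_mem_Ioo hn0 hx
  rw [Real.norm_eq_abs, abs_of_pos (one_div_pos.mpr (by linarith [hu.2]))]
  exact one_div_one_sub_prod_le hn0 hx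

/-! ### The evaluation -/

/-- On the open unit box the geometric series sums the kernel:
`Σ_{k≥0} (x₀⋯x_{n−1})ᵏ = 1/(1 − x₀⋯x_{n−1})` (`n ≥ 1`). [folklore] -/
theorem hasSum_prod_pow (hn : n ≠ 0) {x : Fin n → ℝ} (hx : ∀ i, x i ∈ Ioo (0 : ℝ) 1) :
    HasSum (fun k : ℕ => (∏ i, x i) ^ k) (1 / (1 - ∏ i, x i)) := by
  have hu := prod_mem_Ioo hn hx
  rw [one_div]
  exact hasSum_geometric_of_lt_one hu.1.le hu.2

/-- `Σ_{k≥0} (1/(k+1))ⁿ` converges for `n ≥ 2` (the tree's `KZ.summable_one_div_succ_pow` of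
`KontsevichZagierZetaProofs.lean`, recast). [folklore] -/
theorem summable_one_div_succ_pow' (hn : 2 ≤ n) : Summable fun k : ℕ => (1 / ((k : ℝ) + 1)) ^ n := by
  refine (Literature.NumberTheory.Transcendental.KZ.summable_one_div_succ_pow
    (by omega : 1 < n)).congr fun k => ?_
  push_cast
  rw [one_div_pow]

/-- **Term-wise integration** on the open box: the integrals `(1/(k+1))ⁿ` of the monomials sum to
the integral of the summed kernel (absolute convergence). [folklore] -/
theorem hasSum_setIntegral_box_prod_pow (hn : 2 ≤ n) :
    HasSum (fun k : ℕ => (1 / ((k : ℝ) + 1)) ^ n)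
      (∫ x in {x : Fin n → ℝ | ∀ i, x i ∈ Ioo (0 : ℝ) 1}, ∑' k : ℕ, (∏ i, x i) ^ k) := by
  have hnorm : ∀ k : ℕ, ∫ x in {x : Fin n → ℝ | ∀ i, x i ∈ Ioo (0 : ℝ) 1}, ‖(∏ i, x i) ^ k‖
      = (1 / ((k : ℝ) + 1)) ^ n := by
    intro k
    rw [← setIntegral_box_prod_pow n k]
    exact setIntegral_congr_fun (Beukers.measurableSet_cube n) fun x hx =>
      Real.norm_of_nonneg (pow_nonneg (Finset.prod_nonneg fun i _ => (hx i).1.le) k)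
  have hsum : Summable fun k : ℕ =>
      ∫ x in {x : Fin n → ℝ | ∀ i, x i ∈ Ioo (0 : ℝ) 1}, ‖(∏ i, x i) ^ k‖ := by
    simp_rw [hnorm]
    exact summable_one_div_succ_pow' hn
  have h := hasSum_integral_of_summable_integral_norm
    (μ := volume.restrict {x : Fin n → ℝ | ∀ i, x i ∈ Ioo (0 : ℝ) 1})
    (F := fun (k : ℕ) (x : Fin n → ℝ) => (∏ i, x i) ^ k) (integrableOn_box_prod_pow n) hsum
  have hfun : (fun k : ℕ => (1 / ((k : ℝ) + 1)) ^ n)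
      = fun k : ℕ => ∫ x in {x : Fin n → ℝ | ∀ i, x i ∈ Ioo (0 : ℝ) 1}, (∏ i, x i) ^ k :=
    funext fun k => (setIntegral_box_prod_pow n k).symm
  rw [hfun]
  exact h

/-- **`ζ(n)` as a period over the open unit box**: for `n ≥ 2`,
`∫_{(0,1)ⁿ} dx/(1 − x₀⋯x_{n−1}) = Σ_{k≥0} 1/(k+1)ⁿ` (expand the geometric series and integrate
term-wise, `∫ (x₀⋯x_{n−1})ᵏ = (1/(k+1))ⁿ`). [folklore] -/
theorem setIntegral_box_one_div_one_sub_prod (hn : 2 ≤ n) :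
    ∫ x in {x : Fin n → ℝ | ∀ i, x i ∈ Ioo (0 : ℝ) 1}, 1 / (1 - ∏ i, x i)
      = ∑' k : ℕ, 1 / ((k : ℝ) + 1) ^ n := by
  have hn0 : n ≠ 0 := by omega
  have h := hasSum_setIntegral_box_prod_pow hn
  simp_rw [one_div_pow] at h
  rw [h.tsum_eq]
  refine setIntegral_congr_fun (Beukers.measurableSet_cube n) fun x hx => ?_
  exact ((hasSum_prod_pow hn0 hx).tsum_eq).symm

/-- The same value as the tree's `zetaValue n = Σ_{m≥0} 1/mⁿ` (whose `m = 0` term is the junk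
`1/0ⁿ = 0`): `Σ_{k≥0} 1/(k+1)ⁿ = zetaValue n` for `n ≥ 2` (the tree's
`KZ.tsum_one_div_succ_pow_eq_zetaValue` of `KontsevichZagierZetaProofs.lean`, recast). [folklore] -/
theorem tsum_one_div_succ_pow_eq_zetaValue' (hn : 2 ≤ n) :
    ∑' k : ℕ, 1 / ((k : ℝ) + 1) ^ n = zetaValue n := by
  rw [← Literature.NumberTheory.Transcendental.KZ.tsum_one_div_succ_pow_eq_zetaValue
    (by omega : 1 < n)]
  refine tsum_congr fun k => ?_
  push_cast
  rfl

/-- **`∫_{(0,1)ⁿ} dx/(1 − x₀⋯x_{n−1}) = ζ(n)`** (`n ≥ 2`), with `ζ(n) = zetaValue n`. [folklore] -/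
theorem setIntegral_box_one_div_one_sub_prod_eq_zetaValue (hn : 2 ≤ n) :
    ∫ x in {x : Fin n → ℝ | ∀ i, x i ∈ Ioo (0 : ℝ) 1}, 1 / (1 - ∏ i, x i) = zetaValue n := by
  rw [setIntegral_box_one_div_one_sub_prod hn, tsum_one_div_succ_pow_eq_zetaValue' hn]

end BoxIntegral

/-! ### Weights `2` and `3` in coordinates -/

/-- **`∫_{(0,1)²} dx₀dx₁/(1 − x₀x₁) = ζ(2) = π²/6`** on the open unit box of `Fin 2 → ℝ`
(Beukers' double integral for `ζ(2)`; the standard example of `ζ(2)` as a period), with the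
integrability of the kernel. [folklore] -/
theorem box_integral_one_div_one_sub_mul_two :
    IntegrableOn (fun x : Fin 2 → ℝ => 1 / (1 - x 0 * x 1)) {x | ∀ i, x i ∈ Ioo (0 : ℝ) 1} volume ∧
      ∫ x in {x : Fin 2 → ℝ | ∀ i, x i ∈ Ioo (0 : ℝ) 1}, 1 / (1 - x 0 * x 1) = Real.pi ^ 2 / 6 := by
  have h1 := BoxIntegral.integrableOn_box_one_div_one_sub_prod (n := 2) le_rfl
  have h2 := BoxIntegral.setIntegral_box_one_div_one_sub_prod (n := 2) le_rfl
  simp only [Fin.prod_univ_two] at h1 h2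
  refine ⟨h1, ?_⟩
  rw [h2]
  have hz := (hasSum_nat_add_iff' 1).mpr hasSum_zeta_two
  simp only [Finset.sum_range_one, Nat.cast_zero, ne_eq, OfNat.ofNat_ne_zero, not_false_eq_true,
    zero_pow, div_zero, sub_zero] at hz
  rw [← hz.tsum_eq]
  refine tsum_congr fun k => ?_
  push_cast
  ring_nf

/-- **`∫_{(0,1)³} dx₀dx₁dx₂/(1 − x₀x₁x₂) = ζ(3)`** on the open unit box of `Fin 3 → ℝ`, with
`ζ(3) = zetaValue 3` (the tree's Apéry constant), and the integrability of the kernel — the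
weight-`3` calibration integral of the Kontsevich–Zagier calculus. [folklore] -/
theorem box_integral_one_div_one_sub_mul_three :
    IntegrableOn (fun x : Fin 3 → ℝ => 1 / (1 - x 0 * x 1 * x 2)) {x | ∀ i, x i ∈ Ioo (0 : ℝ) 1} volume ∧
      ∫ x in {x : Fin 3 → ℝ | ∀ i, x i ∈ Ioo (0 : ℝ) 1}, 1 / (1 - x 0 * x 1 * x 2) = zetaValue 3 := by
  have h1 := BoxIntegral.integrableOn_box_one_div_one_sub_prod (n := 3) (by norm_num)
  have h2 := BoxIntegral.setIntegral_box_one_div_one_sub_prod_eq_zetaValue (n := 3) (by norm_num)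
  simp only [Fin.prod_univ_three] at h1 h2
  exact ⟨h1, h2⟩

end Literature.NumberTheory.Transcendental
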